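import Literature.Probability.Percolation.IntPairRoutes
import Literature.Probability.Percolation.TrapPairCutCore
import HarnessLib

/-!
# The inner pair step: good sets and the planar contradictions (twin of `TrapPairCutCore.lean`)

Topic `Literature/Probability/Percolation`; family `crit-perc` / near-critical percolation on `𝕋`.
A brick of the INNER half of the near-critical arm-separation theorem for four arms in the ADJACENT
colour arrangement (P. Nolin, EJP 13 (2008), Thm. 11, `j = 4`, `σ = BBWW` [arXiv 0711.4948:
Thm. 10], §4.4 Lemma 15, internal extremities, last paragraph of the proof). In the setting
`IntPairData`, twin of the `GoodSet` part of `TrapPairCutCore.lean` (the generic `SiteConn` /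
`siteComp` of that file are reused): `GoodSet`, `GoodSet.false_of_tip` (no low bypass),
`GoodSet.not_mem_term` (no high bypass), `tip_row_lt`, `GoodSet.false_of_tip_mem`,
`GoodSet.false_of_fence`.

Everything here is proved; no named facts are introduced.

## References

* P. Nolin, Near-critical percolation in two dimensions, *Electron. J. Probab.* 13 (2008), §4.4,
  proof of Lemma 15, internal extremities (arXiv 0711.4948: Lemma 14), last paragraph [Nolin2008].
* H. Kesten, *Percolation theory for mathematicians* (1982), §2.3 [KestenPTM1982].
-/

noncomputable section

open Set

namespace Literature.Probability.Percolation

open LatticeModels HalfAnnulus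

/-! ### Good sets and the planar contradictions -/

namespace IntPairData

variable {m N k₀ K T R₀ : ℕ} {ω : SiteConfig (Site 2)}

/-- **A good set** for the arm `j` (minimal term `c = c_{u_j}`): an open connected set of sites
of the half-annulus avoiding the final crossing `α_j` and every term before `c`. [folklore] -/
structure GoodSet (D : IntPairData m N k₀ K T R₀ ω) (j : Fin 2) (S : Set (Site 2)) : Prop where
  sub_D : S ⊆ ↑(haFin m)
  sub_ω : S ⊆ ω
  conn : SiteConn S
  avoid : ∀ v ∈ S, v ∉ D.αF j
  stage : ∀ v' < D.uMin j, ∀ c' z', (intDom m).lowestSeq ω v' = some (c', z') → ∀ v ∈ S, v ∉ c'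

namespace GoodSet

variable {D : IntPairData m N k₀ K T R₀ ω} {j : Fin 2} {A B : Set (Site 2)}

/-- Union of good sets linked by a common site or an edge. [folklore] -/
theorem union_of_link (hA : D.GoodSet j A) (hB : D.GoodSet j B) {a b : Site 2} (ha : a ∈ A) (hb : b ∈ B)
    (hlink : a = b ∨ triGraph.Adj a b) : D.GoodSet j (A ∪ B) where
  sub_D := Set.union_subset hA.sub_D hB.sub_D
  sub_ω := Set.union_subset hA.sub_ω hB.sub_ω
  conn := by
    rcases hlink with rfl | hadj
    · exact hA.conn.union_of_mem hB.conn ha hb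
    · exact hA.conn.union_of_adj hB.conn ha hb hadj
  avoid := fun v hv => hv.elim (hA.avoid v) (hB.avoid v)
  stage := fun v' hv' c' z' h v hv => hv.elim (hA.stage v' hv' c' z' h v) (hB.stage v' hv' c' z' h v)

/-- A good set lies in `D ∖ α_j`. [folklore] -/
theorem sub_sdiff (hA : D.GoodSet j A) : A ⊆ (↑((intDom m).D \ D.αF j) : Set (Site 2)) := fun w hw => by
  rw [Finset.coe_sdiff]; exact ⟨hA.sub_D hw, fun h => hA.avoid w hw h⟩

end GoodSet

/-- **Lemma B for a good set (no low bypass)**: a good set starting on `trapI M` whose only site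
on `trapO M` is `b`, lower than the tip of `α_j`, is impossible — it is an open crossing of the
stage of `c` disjoint from `α_j`, so `α_j` could not meet `c`. [cite: Nolin2008, §4.4 Lemma 15 (proof) (arXiv 0711.4948: Lemma 14, last paragraph)] -/
theorem GoodSet.false_of_tip {D : IntPairData m N k₀ K T R₀ ω} {j : Fin 2} {S : Set (Site 2)} (hS : D.GoodSet j S)
    {c : Finset (Site 2)} {z : Site 2} (hu : (intDom m).lowestSeq ω (D.uMin j) = some (c, z))
    (hf : ∃ f ∈ S, f ∈ (intDom m).F) {b : Site 2} (hbS : b ∈ S) (hbO : b ∈ (intDom m).J)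
    (htip : ∀ v ∈ S, v ∈ (intDom m).J → v = b) (hlt : b 1 < (D.y j) 1) : False := by
  classical
  have hcut := D.hcut
  have hfin : S.Finite := (Finset.finite_toSet (haFin m)).subset hS.sub_D
  set Kf := hfin.toFinset with hKf'
  have hcoe : (↑Kf : Set (Site 2)) = S := hfin.coe_toFinset
  have hmem : ∀ v, v ∈ Kf ↔ v ∈ S := fun v => hfin.mem_toFinset
  have hcr : (intDom m).IsCrossing Kf b :=
    { subset := fun v hv => Finset.mem_coe.1 (hS.sub_D ((hmem v).1 hv))
      tip_mem := (hmem b).2 hbS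
      tip_mem_J := hbO
      eq_tip := fun v hv hvJ => htip v ((hmem v).1 hv) hvJ
      exists_start := by obtain ⟨f, hf, hfI⟩ := hf; exact ⟨f, (hmem f).2 hf, hfI⟩
      conn := fun u hu' v hv => by rw [hcoe]; exact hS.conn u ((hmem u).1 hu') v ((hmem v).1 hv) }
  have hKfω : (↑Kf : Set (Site 2)) ⊆ ω := by rw [hcoe]; exact hS.sub_ω
  have hdisjα : Disjoint Kf (D.αF j) := Finset.disjoint_left.2 fun v hv hv' => hS.avoid v ((hmem v).1 hv) hv'
  have hKabove : ∀ v' c' z', v' + 1 = D.uMin j → (intDom m).lowestSeq ω v' = some (c', z') →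
      Kf ⊆ (intDom m).above c' z' :=
    fun v' c' z' hv' h => JDomain.subset_above_of_forall_disjoint hcr hKfω v'
      (fun v'' hv'' c'' z'' h'' => Finset.disjoint_left.2 fun x hx hx'' =>
        hS.stage v'' (by omega) c'' z'' h'' x ((hmem x).1 hx) hx'') c' z' h
  have := JDomain.disjoint_of_stage_crossing hcut D.hdual hu hcr hKfω hKabove (D.αF_isCrossing j) hdisjα
    (by simpa using hlt)
  obtain ⟨x, hx⟩ := D.αF_meet j hu
  rw [Finset.mem_inter] at hx
  exact Finset.disjoint_left.1 this hx.1 hx.2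

/-- **Lemma A for a good set (no high bypass)**: a good set containing a site of `Tp` or of the
tip arc above the tip of `α_j` contains no site of `c`. [cite: Nolin2008, §4.4 Lemma 15 (proof) (arXiv 0711.4948: Lemma 14, last paragraph)] -/
theorem GoodSet.not_mem_term {D : IntPairData m N k₀ K T R₀ ω} {j : Fin 2} {S : Set (Site 2)} (hS : D.GoodSet j S)
    {c : Finset (Site 2)} {z : Site 2} (hu : (intDom m).lowestSeq ω (D.uMin j) = some (c, z))
    {r : Site 2} (hrS : r ∈ S) (hr : r ∈ (intDom m).Tp ∪ (intDom m).Jabove (D.y j)) :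
    ∀ v ∈ S, v ∉ c := fun _ hvS hvc =>
  Set.disjoint_left.1 (JDomain.disjoint_term_of_conn_ref D.hcut D.hdual hu (D.αF_isCrossing j)
    (D.αF_open j) (D.αF_stage j) hS.sub_sdiff hS.conn hrS hr) hvS (Finset.mem_coe.2 hvc)

/-- **The tip of the minimal term is lower than the tip of the arm** when it is off `α_j`. [folklore] -/
theorem tip_row_lt (D : IntPairData m N k₀ K T R₀ ω) (j : Fin 2) {c : Finset (Site 2)} {z : Site 2}
    (hu : (intDom m).lowestSeq ω (D.uMin j) = some (c, z)) (hzα : z ∉ D.αF j) : z 1 < (D.y j) 1 := by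
  have hcut := D.hcut
  have hc := term_isCrossing hu
  have hα := D.αF_isCrossing j
  have hL : c ⊆ (intDom m).lower (D.αF j) (D.y j) :=
    JDomain.term_subset_lower hcut D.hdual hu hα (D.αF_open j) (D.αF_stage j)
  have hzO := (term_isCrossing hu).tip_mem_J
  have hzy : z ≠ D.y j := fun h => hzα (h ▸ hα.tip_mem)
  have hle : ¬ (D.y j) 1 < z 1 := fun hlt => by
    have hza : z ∈ (intDom m).above (D.αF j) (D.y j) := hα.mem_above_of_mem_Jabove (JDomain.mem_Jabove.2 ⟨hzO, by simpa using hlt⟩)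
    exact (JDomain.mem_lower_iff_not_mem_above (hc.subset hc.tip_mem)).1 (hL hc.tip_mem) hza
  have hne : z 1 ≠ (D.y j) 1 := fun h => hzy (Site.eq_iff_two.2 ⟨(mem_intDom_J.1 hzO).2.1.trans (D.y_isIntJ j).1.symm, h⟩)
  omega

/-- **A good set through the tip of the minimal term** (starting on `trapI M`, meeting `trapO M`
only at `z`) is impossible. [cite: Nolin2008, §4.4 Lemma 15 (proof) (arXiv 0711.4948: Lemma 14, last paragraph)] -/
theorem GoodSet.false_of_tip_mem {D : IntPairData m N k₀ K T R₀ ω} {j : Fin 2} {S : Set (Site 2)} (hS : D.GoodSet j S)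
    {c : Finset (Site 2)} {z : Site 2} (hu : (intDom m).lowestSeq ω (D.uMin j) = some (c, z))
    (hf : ∃ f ∈ S, f ∈ (intDom m).F) (hzS : z ∈ S) (htip : ∀ v ∈ S, v ∈ (intDom m).J → v = z) : False :=
  hS.false_of_tip hu hf hzS (term_isCrossing hu).tip_mem_J htip (D.tip_row_lt j hu (hS.avoid z hzS))

/-- **A good set attached to the fence of the minimal term** — containing a site `w₀` of `c` and
the attachment site `q` of the fence of `c`, starting on `trapI M`, and missing `trapO M` — is
impossible: follow the fence connection from `q` out of `Λ_{2M}` (see the module docstring). [cite: Nolin2008, §4.4 Lemma 15 (proof) (arXiv 0711.4948: Lemma 14, last paragraph)] -/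
theorem GoodSet.false_of_fence {D : IntPairData m N k₀ K T R₀ ω} {j : Fin 2} {S : Set (Site 2)} (hS : D.GoodSet j S)
    {c : Finset (Site 2)} {z : Site 2} (hu : (intDom m).lowestSeq ω (D.uMin j) = some (c, z))
    (hf : ∃ f ∈ S, f ∈ (intDom m).F) (hO : ∀ v ∈ S, v ∉ (intDom m).J) {w₀ : Site 2} (hw₀ : w₀ ∈ S) (hw₀c : w₀ ∈ c)
    (hq : (D.fence hu).q ∈ S) : False := by
  classical
  have hcut := D.hcut
  have hc := term_isCrossing hu
  have hzO : z ∈ (intDom m).J := (term_isCrossing hu).tip_mem_J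
  have hk := D.one_le_kOf hu
  set Tf := D.fence hu with hTf
  have hqO : Tf.q ∉ (intDom m).J := hO _ hq
  have hqD : Tf.q ∈ haFin m := hS.sub_D hq
  have hqz : Tf.q ≠ z := fun h => hqO (by rw [h]; exact hzO)
  obtain ⟨hz0, hz1, hz2⟩ := (mem_intDom_J.1 hzO).2
  have hmid := D.tip_midOf hu
  have hk' : (1 : ℤ) ≤ D.kOf hu := by exact_mod_cast hk
  have hpbox := intFenceSet_box (Tf.F_subset Tf.path.left_mem)
  have hqp := (triGraph_adj_iff_coord Tf.q Tf.p).1 Tf.adj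
  by_cases hpn : (m : ℤ) ≤ triNorm Tf.p
  swap
  · -- the attachment site is an inner-boundary site next to the inner site `p` above the row of `z`: top-type
    rw [not_le] at hpn
    have hrow := mem_intFenceSet_beyond (Tf.F_subset Tf.path.left_mem) hpn
    have hqn : triNorm Tf.q = m := by
      have h1 := (mem_haFin.1 hqD).2.1
      have h2 := triNorm_le_triNorm_add_one_of_adj Tf.adj.symm
      omega
    have hq0 : Tf.q 0 = m := by
      have hqn' := hqn
      rw [triNorm_eq_max] at hqn'
      rcases hqp with h | h | h | h | h | h <;> omega
    have hN : Tf.q ∈ (intDom m).Tp ∪ (intDom m).Jabove z := by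
      rcases int_sType_or_nType hqD hqn (Or.inl hq0) hzO hqz with hS' | hN
      · exfalso
        simp only [Finset.mem_union, mem_intDom_Bt, JDomain.mem_Jbelow, mem_intDom_J, intDom_ht] at hS'
        have hq1 : z 1 ≤ Tf.q 1 := by rcases hqp with h | h | h | h | h | h <;> omega
        have hqz1 : Tf.q 1 ≠ z 1 := fun h => hqz (Site.eq_iff_two.2 ⟨hq0.trans hz0.symm, h⟩)
        rcases hS' with ⟨-, -, hB⟩ | ⟨-, hlt⟩
        · rcases hB with h | ⟨-, h⟩ <;> omega
        · omega
      · exact hN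
    have hqTp : Tf.q ∈ (intDom m).Tp := by
      rcases Finset.mem_union.1 hN with h | h
      · exact h
      · exact absurd (JDomain.mem_Jabove.1 h).1 hqO
    exact hS.not_mem_term hu hq (Finset.mem_union_left _ hqTp) w₀ hw₀ hw₀c
  -- follow the connection from `p` to its first exit
  obtain ⟨x', e, hx'n, hen, -, hadj, hpath⟩ := Tf.exists_exit hk (tip_isIntJ' hu) (by omega) Tf.path.left_mem hpn
  obtain ⟨S₁, hS₁, hpS₁, htS₁⟩ := hpath.exists_support
  have hS₁F : ∀ v ∈ S₁, v ∈ Tf.F := fun v hv => (hS₁ hv).2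
  have hS₁n : ∀ v ∈ S₁, (m : ℤ) ≤ triNorm v := fun v hv => (hS₁ hv).1
  have hS₁in : ∀ v ∈ S₁, v ∈ haFin m ∧ v ∈ (intDom m).above c z ∧ v ∉ c := fun v hv =>
    mem_intFenceSet_inside (Tf.F_subset (hS₁F v hv)) (hS₁n v hv)
  have hS₁arm : ∀ v ∈ S₁, v ∉ D.armSet := fun v hv => D.fence_disjoint_arm hu (hS₁F v hv)
  have hS₁good : D.GoodSet j S₁ :=
    { sub_D := fun v hv => Finset.mem_coe.2 (hS₁in v hv).1
      sub_ω := fun v hv => intFenceSet_subset (Tf.F_subset (hS₁F v hv))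
      conn := fun x hx y hy => (htS₁ x hx).symm.trans (htS₁ y hy)
      avoid := fun v hv h => hS₁arm v hv (D.mem_armSet (D.αF_subset j v h))
      stage := fun v' _ c' z' h v hv => D.fence_disjoint_term hu h (hS₁F v hv) }
  have hpS : Tf.p ∈ S₁ := hpS₁.left_mem
  have hbig : D.GoodSet j (S ∪ S₁) := hS.union_of_link hS₁good hq hpS (Or.inr Tf.adj)
  by_cases hr : ∃ r ∈ S₁, r ∈ (intDom m).Tp ∪ (intDom m).Jabove (D.y j)
  · obtain ⟨r, hrS, hr⟩ := hr
    exact hbig.not_mem_term hu (Or.inr hrS) hr w₀ (Or.inl hw₀) hw₀c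
  push Not at hr
  -- rows of the tip-arc sites of `S₁` are below the tip of `α_j`
  have hrowO : ∀ b ∈ S₁, b ∈ (intDom m).J → b 1 < (D.y j) 1 := by
    intro b hbS hbO
    have h1 : ¬ (D.y j) 1 < b 1 := fun h => hr b hbS (Finset.mem_union_right _ (JDomain.mem_Jabove.2 ⟨hbO, by simpa using h⟩))
    have h2 : b ≠ D.y j := fun h => hS₁arm b hbS (h ▸ D.mem_armSet (D.A j).end_mem_support)
    have h3 : b 1 ≠ (D.y j) 1 := fun h => h2 (Site.eq_iff_two.2 ⟨(mem_intDom_J.1 hbO).2.1.trans (D.y_isIntJ j).1.symm, h⟩)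
    omega
  -- the last half-annulus site `x'` is top-type for `z`, hence on the tip arc
  have hx'S : x' ∈ S₁ := hpS₁.right_mem
  have hx'D := (hS₁in x' hx'S).1
  have hx'b : triNorm x' = m := by have := triNorm_le_triNorm_add_one_of_adj hadj.symm; omega
  have hx'z : x' ≠ z := fun h => (hS₁in x' hx'S).2.2 (h ▸ hc.tip_mem)
  have hx'box := intFenceSet_box (Tf.F_subset (hS₁F x' hx'S))
  have hx'0 : x' 0 = m := by
    have hx'e := (triGraph_adj_iff_coord x' e).1 hadj
    have hx'b' := hx'b
    have hen' := hen
    rw [triNorm_eq_max] at hx'b' hen'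
    rcases hx'e with h | h | h | h | h | h <;> omega
  have hx'O : x' ∈ (intDom m).J := by
    rcases int_sType_or_nType hx'D hx'b (Or.inl hx'0) hzO hx'z with hS' | hN
    · exact absurd (hS₁in x' hx'S).2.1 (hc.not_mem_above_of_mem_Bt_union hcut hS')
    · rcases Finset.mem_union.1 hN with h | h
      · exact absurd (Finset.mem_union_left _ h) (hr x' hx'S)
      · exact (JDomain.mem_Jabove.1 h).1
  -- the first tip-arc site `b` along the connection from `p`, and the continuation `S₂` before it
  obtain ⟨S₂, b, hS₂, hS₂O, hbS, hbO, hgood⟩ : ∃ (S₂ : Set (Site 2)) (b : Site 2), S₂ ⊆ S₁ ∧ (∀ v ∈ S₂, v ∉ (intDom m).J) ∧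
      b ∈ S₁ ∧ b ∈ (intDom m).J ∧ D.GoodSet j (S ∪ S₂ ∪ {b}) := by
    have hsingle : ∀ b ∈ S₁, D.GoodSet j ({b} : Set (Site 2)) := fun b hb =>
      { sub_D := fun v hv => by rw [Set.mem_singleton_iff.1 hv]; exact hS₁good.sub_D hb
        sub_ω := fun v hv => by rw [Set.mem_singleton_iff.1 hv]; exact hS₁good.sub_ω hb
        conn := siteConn_singleton b
        avoid := fun v hv => by rw [Set.mem_singleton_iff.1 hv]; exact hS₁good.avoid b hb
        stage := fun v' hv' c' z' h v hv => by rw [Set.mem_singleton_iff.1 hv]; exact hS₁good.stage v' hv' c' z' h b hb }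
    by_cases hpO : Tf.p ∈ (intDom m).J
    · refine ⟨∅, Tf.p, Set.empty_subset _, fun v hv => absurd hv (Set.notMem_empty v), hpS, hpO, ?_⟩
      rw [Set.union_empty]
      exact hS.union_of_link (hsingle _ hpS) hq (Set.mem_singleton _) (Or.inr Tf.adj)
    · obtain ⟨a, b, haO, hbO, hbS, hab, hpa⟩ := hpS₁.exit (R := (↑((intDom m).J) : Set (Site 2))ᶜ) hpO (fun h => h hx'O)
      obtain ⟨S₂, hS₂, hpS₂, htS₂⟩ := hpa.exists_support
      have hbO' : b ∈ (intDom m).J := not_not.1 hbO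
      have hS₂S₁ : S₂ ⊆ S₁ := fun v hv => (hS₂ hv).2
      have hS₂good : D.GoodSet j S₂ :=
        { sub_D := fun v hv => hS₁good.sub_D (hS₂S₁ hv)
          sub_ω := fun v hv => hS₁good.sub_ω (hS₂S₁ hv)
          conn := fun x hx y hy => (htS₂ x hx).symm.trans (htS₂ y hy)
          avoid := fun v hv => hS₁good.avoid v (hS₂S₁ hv)
          stage := fun v' hv' c' z' h v hv => hS₁good.stage v' hv' c' z' h v (hS₂S₁ hv) }
      refine ⟨S₂, b, hS₂S₁, fun v hv => (hS₂ hv).1, hbS, hbO', ?_⟩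
      exact (hS.union_of_link hS₂good hq hpS₂.left_mem (Or.inr Tf.adj)).union_of_link (hsingle b hbS)
        (Or.inr hpS₂.right_mem) (Set.mem_singleton b) (Or.inr hab)
  -- `S ∪ S₂ ∪ {b}` has the single tip-arc site `b`, lower than the tip of `α_j`: Lemma B
  refine hgood.false_of_tip hu ?_ (Set.mem_union_right _ (Set.mem_singleton b)) hbO ?_ (hrowO b hbS hbO)
  · obtain ⟨f, hf', hfI⟩ := hf; exact ⟨f, Or.inl (Or.inl hf'), hfI⟩
  · rintro v ((hv | hv) | hv) hvO
    · exact absurd hvO (hO v hv)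
    · exact absurd hvO (hS₂O v hv)
    · exact Set.mem_singleton_iff.1 hv

end IntPairData

end Literature.Probability.Percolation
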